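import Literature.Computability.Cryptography.HallgrenClassGroupIdealEnumerationProduct
import Literature.Computability.Cryptography.HallgrenClassGroupBlockFP
import Literature.Computability.Cryptography.HallgrenClassGroupOrderInj
import Literature.Computability.Complexity.CodeFPFinite
import Literature.Computability.Complexity.CodeFPModArith
import HarnessLib

/-!
# The machine form of the ideal enumeration (Cohen 1993, §5.2): roots as data, a left fold of
clamped compositions, and agreement with `enumForm`

Third part of the dictionary "ideals of norm `a` ↔ mixed-radix digits" of
`HallgrenClassGroupIdealEnumeration(Product).lean`. There the reduced form `enumForm D F k` of the
`k`-th ideal of norm `∏ p^e` is a right-nested `compose` of local forms `localForm D p e j`, each a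
`compose` of powers `formPow` of the prime form `(p, β, ·)` with `β = primeRoot D p` the LEAST square
root of `D` modulo `4p` in `[0, 2p)`. A polynomial-time machine cannot search `[0, 2p)`; it is HANDED
the roots (found by a randomised root finder elsewhere) and works with

* `localCountR p e r`, `localFormR D p e j r` — the local count / local form computed from a root
  OPTION `r : Option ℕ` in place of `primeRoot D p`, the powers by the binary method `ClBlockFP.powG`
  and the products by the clamped composition `ClBlockFP.compC` (both already on codes);
* `enumStep`, `enumCountR L`, `enumFormR D L k` — for a list `L` of triples `(p, e, r)`: the product of
  the local counts, and the LEFT fold over `L` of "consume the next mixed-radix digit of `k`, compose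
  the accumulator with the selected local form";
* `withRoots D F` — the list `F = [(p, e)]` decorated with the canonical roots `primeRoot D p`;
* `toTriple f = (a, b, c)` as `ℕ × ℤ × ℕ` and the query string
  `twQuery d k L = code(d, [toTriple (enumFormR (−d) L k)])` (the Hallgren instance "order of the class
  of the `k`-th ideal"), empty when `k ≥ enumCountR L`.

Agreement (maximal order of an imaginary quadratic field `K`, `D = d_K`):
`powG_eq_formPow` (binary method = iterated composition on primitive forms: both are the reduced form
of the class `[g]^n`, `OrderCl.classOf'_inj`), `localCountR_primeRoot`, `localFormR_primeRoot`,
`enumCountR_withRoots`, **`enumFormR_withRoots`** (`enumFormR D (withRoots D F) k = enumForm D F k`: the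
left fold and the right-nested composition are reduced forms of the same class, `classOf_inj`),
`twQuery_withRoots`; and the instance facts `toForm_toTriple`, `isClInstance_toTriple`.

## References

* H. Cohen, *A Course in Computational Algebraic Number Theory*, GTM 138, Springer 1993, §5.2,
  §5.4 [Cohen1993].
* D. A. Cox, *Primes of the form x² + ny²*, 2nd ed., Wiley 2013, §3.A, §7.B Thm. 7.7 [Cox2013].
-/

namespace Literature.Computability.Cryptography.Hallgren2005

namespace FormComposition

open Module NumberField
open Literature.NumberTheory.QuadraticFields.Quadratic Literature.NumberTheory.QuadraticFields.Quadratic.BinQF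
open Literature.NumberTheory.EllipticCurves Composition Reduction ClBlockFP OrderCl

/-! ### Definitions -/

/-- The local count from a root option: `e + 1` (split), `1` (ramified), `[2 ∣ e]` (inert).
[cite: Cohen1993, §5.2] -/
def localCountR (p e : ℕ) : Option ℕ → ℕ
  | none => if 2 ∣ e then 1 else 0
  | some β => if (p : ℤ) ∣ (β : ℤ) then 1 else e + 1

/-- The local form from a root option, by the binary method and clamped compositions.
[cite: Cohen1993, §5.2, §5.4] -/
def localFormR (D : ℤ) (p e j : ℕ) : Option ℕ → BinQF
  | none => one D
  | some β => compC D (powG D (primeForm D p β) j) (powG D (primeForm D p (-(β : ℤ))) (e - j))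

/-- One step of the enumeration fold on `(remaining digits, accumulator)`: consume the digit of the
triple `(p, e, r)` and compose with the selected local form. [cite: Cohen1993, §5.2] -/
def enumStep (D : ℤ) (st : ℕ × BinQF) (t : ℕ × ℕ × Option ℕ) : ℕ × BinQF :=
  (st.1 / localCountR t.1 t.2.1 t.2.2,
    compC D st.2 (localFormR D t.1 t.2.1 (st.1 % localCountR t.1 t.2.1 t.2.2) t.2.2))

/-- The number of enumerated forms: the product of the local counts. [cite: Cohen1993, §5.2] -/
def enumCountR (L : List (ℕ × ℕ × Option ℕ)) : ℕ := (L.map fun t => localCountR t.1 t.2.1 t.2.2).prod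

/-- **The machine enumeration**: the accumulator of the left fold of `enumStep` from `(k, one)`.
[cite: Cohen1993, §5.2] -/
def enumFormR (D : ℤ) (L : List (ℕ × ℕ × Option ℕ)) (k : ℕ) : BinQF := (L.foldl (enumStep D) (k, one D)).2

/-- The prime-power list decorated with the canonical roots. [folklore] -/
def withRoots (D : ℤ) (F : List (ℕ × ℕ)) : List (ℕ × ℕ × Option ℕ) :=
  F.map fun pe => (pe.1, pe.2, primeRoot D pe.1)

/-- A form as a triple `(a, b, c) : ℕ × ℤ × ℕ` (the instance format of `encodeClInstance`). [folklore] -/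
def toTriple (f : BinQF) : ℕ × ℤ × ℕ := (f.a.toNat, f.b, f.c.toNat)

/-- **The query of the torsion-witness bit**: the Hallgren instance `(d, [k-th form])`, or the empty
string when `k` is out of range. [folklore] -/
def twQuery (d k : ℕ) (L : List (ℕ × ℕ × Option ℕ)) : List Bool :=
  if k < enumCountR L then encodeClInstance d [toTriple (enumFormR (-(d : ℤ)) L k)] else []

/-! ### Field-free agreement -/

/-- `localCount` is `localCountR` at the canonical root. [folklore] -/
theorem localCountR_primeRoot (D : ℤ) (p e : ℕ) : localCountR p e (primeRoot D p) = localCount D p e := by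
  unfold localCount
  cases primeRoot D p <;> rfl

/-- `enumCount` is `enumCountR` of the decorated list. [folklore] -/
theorem enumCountR_withRoots (D : ℤ) : ∀ F : List (ℕ × ℕ), enumCountR (withRoots D F) = enumCount D F
  | [] => rfl
  | pe :: F => by
    have ih := enumCountR_withRoots D F
    simp only [enumCountR, withRoots, List.map_cons, List.map_map, List.prod_cons, enumCount] at ih ⊢
    rw [localCountR_primeRoot, ← ih]

/-- `enumFormR` unfolds one triple. [folklore] -/
theorem enumFormR_cons (D : ℤ) (t : ℕ × ℕ × Option ℕ) (L : List (ℕ × ℕ × Option ℕ)) (k : ℕ) :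
    enumFormR D (t :: L) k = (L.foldl (enumStep D) (enumStep D (k, one D) t)).2 := rfl

/-- **The binary method agrees with iterated composition** on primitive positive definite forms of a
negative discriminant: both return the reduced form of the class `[g]^n`. [cite: Cox2013, §3.A, §2.A Thm. 2.8] -/
theorem powG_eq_formPow (Δ : NegDiscr) {g : BinQF} (hg : g.IsPosPrim Δ.D) (n : ℕ) :
    powG Δ.D g n = formPow Δ.D g n := by
  obtain ⟨h1, h2, h3⟩ := powG_spec Δ hg.emod_four hg n
  obtain ⟨g1, g2, g3⟩ := formPow_spec' Δ hg n
  exact classOf'_inj Δ h1 g1 h2 g2 (h3.trans g3.symm)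

/-- A reduced positive definite form has `0 < c`. [folklore] -/
theorem c_pos_of_isReduced {D : ℤ} {f : BinQF} (hf : f.IsPosPrim D) (hr : f.IsReduced) : 0 < f.c :=
  lt_of_lt_of_le hf.a_pos hr.2.1

/-- `toForm (toTriple f) = f` for a reduced positive definite form. [folklore] -/
theorem toForm_toTriple {D : ℤ} {f : BinQF} (hf : f.IsPosPrim D) (hr : f.IsReduced) :
    toForm (toTriple f) = f := by
  obtain ⟨a, b', c⟩ := f
  have ha : 0 < a := hf.a_pos
  have hc : 0 < c := c_pos_of_isReduced hf hr
  simp only [toForm, toTriple, Int.toNat_of_nonneg ha.le, Int.toNat_of_nonneg hc.le]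

/-- A reduced primitive positive definite form of discriminant `−d < 0` is a one-form instance.
[folklore] -/
theorem isClInstance_toTriple {d : ℕ} {f : BinQF} (hd : 0 < d) (hf : f.IsPosPrim (-(d : ℤ)))
    (hr : f.IsReduced) : IsClInstance d [toTriple f] := by
  refine ⟨hd, hf.emod_four, fun q hq => ?_⟩
  rw [List.mem_singleton] at hq
  subst hq
  rw [toForm_toTriple hf hr]
  exact ⟨hf, hr⟩

/-! ### Agreement in the maximal order -/

section Ring

variable {K : Type*} [Field K] [NumberField K] (b : Basis (Fin 2) ℤ (𝓞 K)) (hb : b 0 = 1)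
  (hω : b 1 * b 1 = (mOf (NumberField.discr K) : 𝓞 K) + (NumberField.discr K : 𝓞 K) * b 1)

include b hb hω in
/-- **`localForm` is `localFormR` at the canonical root.** [cite: Cohen1993, §5.2, §5.4] -/
theorem localFormR_primeRoot (hK : IsImaginaryQuadratic K) {p : ℕ} (hp : p.Prime) (e j : ℕ) :
    localFormR (NumberField.discr K) p e j (primeRoot (NumberField.discr K) p) =
      localForm (NumberField.discr K) p e j := by
  rcases hr : primeRoot (NumberField.discr K) p with _ | β
  · simp only [localFormR, localForm, hr]
  · obtain ⟨-, hβ, -⟩ := primeRoot_eq_some_iff.1 hr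
    have h1 := isPosPrim_primeForm b hb hω hK hp hβ
    have h2 := isPosPrim_primeForm b hb hω hK hp (dvd_neg_sq_sub hβ)
    let Δ : NegDiscr := ⟨NumberField.discr K, hK.discr_neg⟩
    simp only [localFormR, localForm, hr]
    rw [powG_eq_formPow Δ h1, powG_eq_formPow Δ h2]
    exact compC_eq_compose hK.discr_neg (formPow_spec' Δ h1 j).1 (formPow_spec' Δ h2 (e - j)).1

/-- `withRoots` unfolds one pair. [folklore] -/
theorem withRoots_cons (D : ℤ) (pe : ℕ × ℕ) (F : List (ℕ × ℕ)) :
    withRoots D (pe :: F) = (pe.1, pe.2, primeRoot D pe.1) :: withRoots D F := rfl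

include hω in
/-- The enumeration fold from `(k, acc)`: a reduced primitive positive definite form of class
`[acc] · [enumForm D F k]`. [cite: Cohen1993, §5.2] -/
theorem foldl_enumStep_withRoots (hK : IsImaginaryQuadratic K) :
    ∀ (F : List (ℕ × ℕ)) (_ : ∀ pe ∈ F, pe.1.Prime) (k : ℕ) (acc : BinQF),
      acc.IsPosPrim (NumberField.discr K) → acc.IsReduced →
      ((withRoots (NumberField.discr K) F).foldl (enumStep (NumberField.discr K)) (k, acc)).2.IsPosPrim
          (NumberField.discr K) ∧
        ((withRoots (NumberField.discr K) F).foldl (enumStep (NumberField.discr K)) (k, acc)).2.IsReduced ∧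
        classOf b hb ((withRoots (NumberField.discr K) F).foldl (enumStep (NumberField.discr K)) (k, acc)).2 =
          classOf b hb acc * classOf b hb (enumForm (NumberField.discr K) F k)
  | [], _, k, acc, ha, har => ⟨ha, har, by simp [withRoots, enumForm, classOf_one' b hb]⟩
  | pe :: F, hF, k, acc, ha, har => by
    have hp : pe.1.Prime := hF pe List.mem_cons_self
    have hF' : ∀ qe ∈ F, qe.1.Prime := fun qe h => hF qe (List.mem_cons_of_mem _ h)
    obtain ⟨l1, l2, -⟩ := mk0_localIdeal b hb hω hK hp pe.2 (k % localCount (NumberField.discr K) pe.1 pe.2)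
    obtain ⟨e1, -, -⟩ := mk0_idealOf b hb hω hK hF' (k / localCount (NumberField.discr K) pe.1 pe.2)
    have hstep : enumStep (NumberField.discr K) (k, acc) (pe.1, pe.2, primeRoot (NumberField.discr K) pe.1) =
        (k / localCount (NumberField.discr K) pe.1 pe.2, compose (NumberField.discr K) acc
          (localForm (NumberField.discr K) pe.1 pe.2 (k % localCount (NumberField.discr K) pe.1 pe.2))) := by
      have e2 := localFormR_primeRoot b hb hω hK hp pe.2 (k % localCount (NumberField.discr K) pe.1 pe.2)
      simp only [enumStep, localCountR_primeRoot]
      rw [e2, compC_eq_compose hK.discr_neg ha l1]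
    have ha' := isPosPrim_compose b hb hω hK ha l1
    have har' := isReduced_compose b hb hω hK ha l1
    obtain ⟨g1, g2, g3⟩ := foldl_enumStep_withRoots hK F hF' (k / localCount (NumberField.discr K) pe.1 pe.2) _ ha' har'
    rw [withRoots_cons, List.foldl_cons, hstep]
    refine ⟨g1, g2, ?_⟩
    rw [g3, classOf_compose b hb hω hK ha l1, enumForm, classOf_compose b hb hω hK l1 e1, mul_assoc]

include b hb hω in
/-- **The machine enumeration with the canonical roots is `enumForm`.** [cite: Cohen1993, §5.2] -/
theorem enumFormR_withRoots (hK : IsImaginaryQuadratic K) {F : List (ℕ × ℕ)} (hF : ∀ pe ∈ F, pe.1.Prime)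
    (k : ℕ) : enumFormR (NumberField.discr K) (withRoots (NumberField.discr K) F) k = enumForm (NumberField.discr K) F k := by
  obtain ⟨o1, o2⟩ := isPosPrim_one hK.discr_neg (discr_emod_four hK.finrank_eq_two)
  obtain ⟨g1, g2, g3⟩ := foldl_enumStep_withRoots b hb hω hK F hF k (one (NumberField.discr K)) o1 o2
  obtain ⟨e1, e2, -⟩ := mk0_idealOf b hb hω hK hF k
  rw [classOf_one' b hb, one_mul] at g3
  exact classOf_inj b hb hω hK g1 e1 g2 e2 g3

include b hb hω in
/-- **The query with the canonical roots** is the instance of the `k`-th enumerated form.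
[cite: Cohen1993, §5.2] -/
theorem twQuery_withRoots (hK : IsImaginaryQuadratic K) {d : ℕ} (hKd : NumberField.discr K = -(d : ℤ))
    (a k : ℕ) :
    twQuery d k (withRoots (NumberField.discr K) (factorPairs a)) =
      if k < enumCount (NumberField.discr K) (factorPairs a) then
        encodeClInstance d [toTriple (enumForm (NumberField.discr K) (factorPairs a) k)] else [] := by
  have hF : ∀ pe ∈ factorPairs a, pe.1.Prime := fun pe h => prime_of_mem_factorPairs h
  rw [twQuery, enumCountR_withRoots, ← hKd, enumFormR_withRoots b hb hω hK hF]

end Ring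

/-! ### The machine enumeration on codes -/

section Codes

open _root_.Computability Literature.Computability.Complexity Literature.Computability.Complexity.CodeFP
open Polynomial ClFP

/-- The code of a triple `(p, e, r)`. [folklore] -/
abbrev tripE : ℕ × ℕ × Option ℕ → List Bool := pairE natE (pairE natE (optE natE))

/-- `localCountR` on codes. [cite: AroraBarak2009, §1.3] -/
theorem localCountRC : CodeFP tripE natE (fun t => localCountR t.1 t.2.1 t.2.2) := by
  have hnone : CodeFP (pairE natE natE) natE (fun s => if decide (s.2 % 2 = 0) then 1 else 0) :=
    ite (natEq.comp ((natMod.comp ((snd _ _).pair (const _ (2 : ℕ)))).pair (const _ (0 : ℕ))))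
      (const _ (1 : ℕ)) (const _ (0 : ℕ))
  have hsome : CodeFP (pairE (pairE natE natE) natE) natE
      (fun s => if decide (s.2 % s.1.1 = 0) then 1 else s.1.2 + 1) :=
    ite (natEq.comp ((natMod.comp ((snd _ _).pair (fst _ _).fst')).pair (const _ (0 : ℕ))))
      (const _ (1 : ℕ)) (natAdd.comp ((fst _ _).snd'.pair (const _ (1 : ℕ))))
  have h := optCases (k := fun (s : ℕ × ℕ) (o : Option ℕ) => localCountR s.1 s.2 o) hnone hsome
    (fun s => by
      simp only [localCountR, Nat.dvd_iff_mod_eq_zero, decide_eq_true_eq])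
    (fun s a => by
      simp only [localCountR, Int.natCast_dvd_natCast, Nat.dvd_iff_mod_eq_zero, decide_eq_true_eq])
  have hin : CodeFP tripE (pairE (pairE natE natE) (optE natE)) (fun t => ((t.1, t.2.1), t.2.2)) :=
    ((fst _ _).pair (snd _ _).fst').pair (snd _ _).snd'
  exact (h.comp hin).congr fun t => rfl

/-- The prime form `(p, β, (β² − D)/(4p))` on codes, from `(D, p, β)`. [cite: AroraBarak2009, §1.3] -/
theorem primeFormC : CodeFP (pairE intE (pairE natE intE)) formE (fun t => primeForm t.1 t.2.1 t.2.2) := by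
  have hD : CodeFP (pairE intE (pairE natE intE)) intE (fun t => t.1) := fst _ _
  have hp : CodeFP (pairE intE (pairE natE intE)) intE (fun t => (t.2.1 : ℤ)) := intOfNat.comp (snd _ _).fst'
  have hβ : CodeFP (pairE intE (pairE natE intE)) intE (fun t => t.2.2) := (snd _ _).snd'
  have hnum := intSub.comp ((intMul.comp (hβ.pair hβ)).pair hD)
  have hden := intMul.comp ((const (pairE intE (pairE natE intE)) (4 : ℤ)).pair hp)
  have hc := intEDiv.comp (hnum.pair hden)
  have h := mkFormC.comp (hp.pair (hβ.pair hc))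
  refine h.congr fun t => ?_
  simp only [primeForm, sq]

/-- `localFormR` on codes, from `(D, (p, e, j), r)`. [cite: AroraBarak2009, §1.3] -/
theorem localFormRC : CodeFP (pairE intE (pairE (pairE natE (pairE natE natE)) (optE natE))) formE
    (fun t => localFormR t.1 t.2.1.1 t.2.1.2.1 t.2.1.2.2 t.2.2) := by
  -- context `s = (D, p, e, j)`, item `β`
  have hD : CodeFP (pairE (pairE intE (pairE natE (pairE natE natE))) natE) intE (fun t => t.1.1) := (fst _ _).fst'
  have hp : CodeFP (pairE (pairE intE (pairE natE (pairE natE natE))) natE) natE (fun t => t.1.2.1) := (fst _ _).snd'.fst'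
  have he : CodeFP (pairE (pairE intE (pairE natE (pairE natE natE))) natE) natE (fun t => t.1.2.2.1) :=
    (fst _ _).snd'.snd'.fst'
  have hj : CodeFP (pairE (pairE intE (pairE natE (pairE natE natE))) natE) natE (fun t => t.1.2.2.2) :=
    (fst _ _).snd'.snd'.snd'
  have hβ : CodeFP (pairE (pairE intE (pairE natE (pairE natE natE))) natE) intE (fun t => (t.2 : ℤ)) :=
    intOfNat.comp (snd _ _)
  have f1 := primeFormC.comp (hD.pair (hp.pair hβ))
  have f2 := primeFormC.comp (hD.pair (hp.pair (intNeg.comp hβ)))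
  have w1 := powGC.comp (hD.pair (f1.pair hj))
  have w2 := powGC.comp (hD.pair (f2.pair (natSub.comp (he.pair hj))))
  have hsome := compCC.comp (hD.pair (w1.pair w2))
  have hnone : CodeFP (pairE intE (pairE natE (pairE natE natE))) formE (fun s => one s.1) := oneC.comp (fst _ _)
  have h := optCases (k := fun (s : ℤ × ℕ × ℕ × ℕ) (o : Option ℕ) => localFormR s.1 s.2.1 s.2.2.1 s.2.2.2 o)
    hnone hsome (fun _ => rfl) (fun _ _ => rfl)
  have hin : CodeFP (pairE intE (pairE (pairE natE (pairE natE natE)) (optE natE)))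
      (pairE (pairE intE (pairE natE (pairE natE natE))) (optE natE)) (fun t => ((t.1, t.2.1), t.2.2)) :=
    ((fst _ _).pair (snd _ _).fst').pair (snd _ _).snd'
  exact (h.comp hin).congr fun t => rfl

/-- `enumStep` on codes, from `(D, st, t)`. [cite: AroraBarak2009, §1.3] -/
theorem enumStepC : CodeFP (pairE intE (pairE (pairE natE formE) tripE)) (pairE natE formE)
    (fun q => enumStep q.1 q.2.1 q.2.2) := by
  have hD : CodeFP (pairE intE (pairE (pairE natE formE) tripE)) intE (fun q => q.1) := fst _ _
  have hk : CodeFP (pairE intE (pairE (pairE natE formE) tripE)) natE (fun q => q.2.1.1) := (snd _ _).fst'.fst'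
  have hacc : CodeFP (pairE intE (pairE (pairE natE formE) tripE)) formE (fun q => q.2.1.2) := (snd _ _).fst'.snd'
  have ht : CodeFP (pairE intE (pairE (pairE natE formE) tripE)) tripE (fun q => q.2.2) := (snd _ _).snd'
  have hℓ := localCountRC.comp ht
  have hdig := natMod.comp (hk.pair hℓ)
  have hlf := localFormRC.comp (hD.pair ((ht.fst'.pair (ht.snd'.fst'.pair hdig)).pair ht.snd'.snd'))
  have h := (natDiv.comp (hk.pair hℓ)).pair (compCC.comp (hD.pair (hacc.pair hlf)))
  exact h.congr fun q => rfl

/-- The enumeration fold keeps `remaining digits ≤ k` and the accumulator small. [folklore] -/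
theorem foldl_enumStep_inv (D : ℤ) (k : ℕ) : ∀ (L : List (ℕ × ℕ × Option ℕ)) (st : ℕ × BinQF),
    st.1 ≤ k → Small D st.2 → (L.foldl (enumStep D) st).1 ≤ k ∧ Small D (L.foldl (enumStep D) st).2
  | [], _, h1, h2 => ⟨h1, h2⟩
  | t :: L, st, h1, _ => by
    have e1 : (enumStep D st t).1 = st.1 / localCountR t.1 t.2.1 t.2.2 := rfl
    have e2 : (enumStep D st t).2 =
        compC D st.2 (localFormR D t.1 t.2.1 (st.1 % localCountR t.1 t.2.1 t.2.2) t.2.2) := rfl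
    have h1' : (enumStep D st t).1 ≤ k := by rw [e1]; exact (Nat.div_le_self _ _).trans h1
    have h2' : Small D (enumStep D st t).2 := by rw [e2]; exact small_compC D _ _
    rw [List.foldl_cons]
    exact foldl_enumStep_inv D k L (enumStep D st t) h1' h2'

/-- **`enumFormR` on codes**, from `(D, L, k)` (a fold with a small accumulator).
[cite: AroraBarak2009, §1.3] -/
theorem enumFormRC : CodeFP (pairE intE (pairE (rawE tripE) natE)) formE (fun t => enumFormR t.1 t.2.1 t.2.2) := by
  have hin1 : CodeFP (pairE (pairE intE natE) (pairE tripE (pairE natE formE))) (pairE intE (pairE (pairE natE formE) tripE))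
      (fun q => (q.1.1, q.2.2, q.2.1)) :=
    (fst _ _).fst'.pair ((snd _ _).snd'.pair (snd _ _).fst')
  have hstep := enumStepC.comp hin1
  have hinit : CodeFP (pairE intE natE) (pairE natE formE) (fun s => (s.2, one s.1)) :=
    (snd _ _).pair (oneC.comp (fst _ _))
  have h := foldl (σ := ℤ × ℕ) (α := ℕ × ℕ × Option ℕ) (β := ℕ × BinQF) (eσ := pairE intE natE) (eα := tripE)
    (eβ := pairE natE formE) (step := fun s t st => enumStep s.1 st t) (init := fun s => (s.2, one s.1))
    hstep hinit (C 16 * X + C 48) (fun s l₁ l₂ => by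
      obtain ⟨D, k⟩ := s
      have e1 : l₁.foldl (fun st t => enumStep D st t) (k, one D) = l₁.foldl (enumStep D) (k, one D) := rfl
      obtain ⟨h1, h2⟩ := foldl_enumStep_inv D k l₁ (k, one D) le_rfl (small_one D)
      have hl := length_formE_le_of_small h2
      have hs := size_abs_succ_le D
      have hk := length_natE_mono h1
      simp only [eval_add, eval_mul, eval_C, eval_X, pairE_apply, length_boolPair]
      rw [e1]
      nlinarith [hl, hs, hk, Nat.zero_le (rawE tripE (l₁ ++ l₂)).length])
  have hin : CodeFP (pairE intE (pairE (rawE tripE) natE)) (pairE (pairE intE natE) (rawE tripE))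
      (fun t => ((t.1, t.2.2), t.2.1)) := ((fst _ _).pair (snd _ _).snd').pair (snd _ _).fst'
  exact ((h.comp hin).snd').congr fun t => rfl

/-- Products of lists of numerals (the code of a product is at most one bit longer than the raw code
of the list). -- adapted from `VanDamSeroussiOracleFP.codeFP_listProd` [folklore] -/
private theorem natListProdC : CodeFP (rawE natE) natE List.prod := by
  have h := foldl₀ (eα := natE) (eβ := natE) (step := fun (a : ℕ) (b : ℕ) => b * a) (b₀ := 1)
    (natMul.comp ((snd _ _).pair (fst _ _))) (Polynomial.X + 1) (fun l₁ l₂ => by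
      rw [Polynomial.eval_add, Polynomial.eval_X, Polynomial.eval_one, ← List.prod_eq_foldl]
      refine (length_natE_le_of_lt (prod_lt_two_pow_length_rawE_succ l₁)).trans ?_
      have := length_rawE_le_of_sublist natE (List.sublist_append_left l₁ l₂)
      omega)
  exact h.congr fun l => by rw [← List.prod_eq_foldl]

/-- `enumCountR` on codes. [cite: AroraBarak2009, §1.3] -/
theorem enumCountRC : CodeFP (rawE tripE) natE enumCountR := by
  have hm := map (σ := Unit) (eσ := fun _ => []) (eα := tripE) (eβ := natE)
    (g := fun q => localCountR q.2.1 q.2.2.1 q.2.2.2) (localCountRC.comp (snd _ _))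
  have h := natListProdC.comp (hm.comp ((const (rawE tripE) ()).pair (CodeFP.id (rawE tripE))))
  exact h.congr fun L => rfl

/-- `toTriple` on codes. [folklore] -/
theorem toTripleC : CodeFP formE (pairE natE (pairE intE natE)) toTriple :=
  ((intToNat.comp aC).pair (bC.pair (intToNat.comp cC))).congr fun _ => rfl

/-- The instance code is the record code of `(d, [triple])`. [folklore] -/
theorem encodeClInstance_singleton_eq (d : ℕ) (q : ℕ × ℤ × ℕ) :
    encodeClInstance d [q] = pairE natE (rawE (pairE natE (pairE intE natE))) (d, [q]) := rfl

/-- **`twQuery` on codes**, from `(d, k, L)`. [cite: AroraBarak2009, §1.3] -/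
theorem twQueryC : CodeFP (pairE natE (pairE natE (rawE tripE))) strE (fun t => twQuery t.1 t.2.1 t.2.2) := by
  have hd : CodeFP (pairE natE (pairE natE (rawE tripE))) natE (fun t => t.1) := fst _ _
  have hk : CodeFP (pairE natE (pairE natE (rawE tripE))) natE (fun t => t.2.1) := (snd _ _).fst'
  have hL : CodeFP (pairE natE (pairE natE (rawE tripE))) (rawE tripE) (fun t => t.2.2) := (snd _ _).snd'
  have hcond := natLt.comp (hk.pair (enumCountRC.comp hL))
  have hq := enumFormRC.comp ((intNeg.comp (intOfNat.comp hd)).pair (hL.pair hk))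
  have hinst : CodeFP (pairE natE (pairE natE (rawE tripE))) strE
      (fun t => encodeClInstance t.1 [toTriple (enumFormR (-(t.1 : ℤ)) t.2.2 t.2.1)]) :=
    (hd.pair ((rawSingleton _).comp (toTripleC.comp hq))).recodeOut fun t => by
      rw [← encodeClInstance_singleton_eq]; rfl
  have h := ite hcond hinst (const _ ([] : List Bool))
  exact h.congr fun t => by
    unfold twQuery
    by_cases hc : t.2.1 < enumCountR t.2.2
    · rw [decide_eq_true hc, if_pos rfl, if_pos hc]
    · rw [decide_eq_false hc, if_neg Bool.false_ne_true, if_neg hc]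

end Codes

end FormComposition

end Literature.Computability.Cryptography.Hallgren2005
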